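import Mathlib.AlgebraicGeometry.Morphisms.QuasiSeparated
import Literature.AlgebraicGeometry.Resolution.IdealSheafFlatDescent
import Literature.AlgebraicGeometry.Resolution.IdealSheafLemmas
import Literature.AlgebraicGeometry.Resolution.StalkIdealLemmas
import HarnessLib

/-!
# Ideal sheaves from AFFINE LOCAL MODELS: extension from one affine open, and gluing a finite family

[OURS · L1 W4.3 · DOOR `HypersurfaceCentreConstruction` (stmt-ResolutionOfSingularities-19897) · E2 CENTRE piece (C-c),
scheme hand (o47-c-scheme), step (G-3) of the registrar's DESIGN MEMO `L/res-L1-w43-plan-1/E2-CENTRE-GLUE-DESIGN-v0.md`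
(e627ce64b29353a8); written by res-D-pv-048 (gen 11).  GENERIC scheme bookkeeping on Mathlib's `Scheme.IdealSheafData` — no
E2 vocabulary; def-free `∃`-statements; `--supports` the door item as a helper.  Replaces the role of: nothing printed; NOT a
statement of [Hironaka2017]; folklore (Hartshorne II.5, quasi-coherent ideal sheaves are determined by, and glue along,
their stalks); AI work, weaker than expert review.]

A LOCAL MODEL on a scheme `Y` is an affine open `W` together with an ideal `I ⊆ Γ(Y, W)`.

* `exists_idealSheafData_of_ideal` — **EXTENSION**: for `Y` quasi-separated there is an ideal sheaf `K` on `Y` whose stalk at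
  every point `y ∈ W` is `I · 𝒪_{Y,y}`, which is `⊤` off the closure of `W ∩ V(I)`, and which is the LARGEST ideal sheaf
  with `K(W) ≤ I` (construction: `K = (I · 𝒪_W)♯ := (ofIdealTop I).map W.ι`, the kernel of `𝒪_Y → (W.ι)_* 𝒪_{V(I)}`;
  stalks by `Literature…IdealSheafFlatDescent.mem_map_ideal_iff`, support by Mathlib's `support_map`);
* `exists_idealSheafData_glue` — **GLUING**: finitely many local models `(W_ℓ, I_ℓ)` that AGREE STALKWISE on the overlaps
  (`I_ℓ · 𝒪_{Y,y} = I_ℓ' · 𝒪_{Y,y}` for `y ∈ W_ℓ ∩ W_ℓ'`) glue to ONE ideal sheaf `R := ⨅_ℓ K_ℓ` with stalks `I_ℓ · 𝒪_{Y,y}`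
  on each `W_ℓ`, `⊤` off `⋃_ℓ closure (W_ℓ ∩ V(I_ℓ))`, sections `R(W_ℓ) = I_ℓ`, and maximal among the ideal sheaves `J` with
  `J(W_ℓ) ≤ I_ℓ` for all `ℓ`.  (The boundary stalks of a single `K_ℓ` outside `W_ℓ` are harmless: `mem_map_ideal_iff` only
  tests points of `W_ℓ`, where the models agree.)
-/

noncomputable section

set_option linter.dupNamespace false

open CategoryTheory AlgebraicGeometry TopologicalSpace IsLocalRing
open Literature.AlgebraicGeometry.Resolution

universe u

namespace Summit.ResolutionOfSingularities.ResolutionOfSingularities.Theorems.LocalModelSheaf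

variable {Y : Scheme.{u}}

/-- The germ at `w : W` of the transport of `s ∈ Γ(Y, W)` to `Γ(W, ⊤)` is `(W.ι)_w^*` of the germ of `s` in `Y`. [folklore] -/
theorem germ_topIso_inv (W : Y.affineOpens) (w : ((W : Y.Opens) : Scheme.{u})) (s : Γ(Y, W)) :
    (((W : Y.Opens) : Scheme.{u}).presheaf.germ ⊤ w trivial).hom ((W : Y.Opens).topIso.inv.hom s) =
      ((W : Y.Opens).ι.stalkMap w).hom ((Y.presheaf.germ (W : Y.Opens) ((W : Y.Opens).ι.base w) w.2).hom s) := by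
  have hw : w ∈ (W : Y.Opens).ι ⁻¹ᵁ (W : Y.Opens) := w.2
  rw [Scheme.Hom.germ_stalkMap_apply (W : Y.Opens).ι (W : Y.Opens) w hw]
  have h1 : (((W : Y.Opens) : Scheme.{u}).presheaf.germ ⊤ w trivial) =
      ((W : Y.Opens) : Scheme.{u}).presheaf.map
          (homOfLE (le_top : (W : Y.Opens).ι ⁻¹ᵁ (W : Y.Opens) ≤ ⊤)).op ≫
        ((W : Y.Opens) : Scheme.{u}).presheaf.germ ((W : Y.Opens).ι ⁻¹ᵁ (W : Y.Opens)) w hw :=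
    (TopCat.Presheaf.germ_res _ _ _ _).symm
  rw [h1, CommRingCat.comp_apply]
  congr 1
  change ((W : Y.Opens).topIso.inv ≫ ((W : Y.Opens) : Scheme.{u}).presheaf.map (homOfLE _).op).hom s =
    ((W : Y.Opens).ι.app (W : Y.Opens)).hom s
  congr 2
  rw [Scheme.Opens.topIso_inv, Scheme.Opens.toScheme_presheaf_map, Scheme.Opens.ι_app]
  exact (Y.presheaf.map_comp _ _).symm.trans (congrArg _ (Subsingleton.elim _ _))

/-- **Stalks of the transported model**: for `w : W`, the stalk of `ofIdealTop (I · Γ(W, ⊤))` at `w` is the image of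
`I · 𝒪_{Y,w}` under the stalk isomorphism `(W.ι)_w^* : 𝒪_{Y,w} ≅ 𝒪_{W,w}`. [folklore] -/
theorem stalkIdeal_ofIdealTop_topIso (W : Y.affineOpens) (I : Ideal Γ(Y, W)) (w : ((W : Y.Opens) : Scheme.{u})) :
    stalkIdeal (Scheme.IdealSheafData.ofIdealTop (I.map (W : Y.Opens).topIso.inv.hom)) w =
      (I.map (Y.presheaf.germ (W : Y.Opens) ((W : Y.Opens).ι.base w) w.2).hom).map ((W : Y.Opens).ι.stalkMap w).hom := by
  haveI : IsAffine ((W : Y.Opens) : Scheme.{u}) := W.2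
  rw [stalkIdeal_eq_map_germ _ ⟨⊤, isAffineOpen_top _⟩ trivial, ideal_ofIdealTop_top, Ideal.map_map, Ideal.map_map]
  apply le_antisymm
  · refine Ideal.map_le_iff_le_comap.mpr fun s hs => ?_
    rw [Ideal.mem_comap, RingHom.comp_apply]
    have h := germ_topIso_inv W w s
    change (((W : Y.Opens) : Scheme.{u}).presheaf.germ ⊤ w trivial).hom ((W : Y.Opens).topIso.inv.hom s) ∈ _
    rw [h, ← RingHom.comp_apply]
    exact Ideal.mem_map_of_mem _ hs
  · refine Ideal.map_le_iff_le_comap.mpr fun s hs => ?_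
    rw [Ideal.mem_comap, RingHom.comp_apply, ← germ_topIso_inv W w s]
    exact Ideal.mem_map_of_mem ((((W : Y.Opens) : Scheme.{u}).presheaf.germ ⊤ w trivial).hom.comp
      (W : Y.Opens).topIso.inv.hom) hs

/-! ## Extension of one local model: `K♯ := (ofIdealTop (I · Γ(W, ⊤))).map W.ι` -/

/-- **STALKS OF THE EXTENSION ON `W`** (`Y` quasi-separated, so `W.ι` is quasi-compact): at `y ∈ W` the stalk of `K♯` is
`I · 𝒪_{Y,y}` (`mem_map_ideal_iff` tests the sections at the points of `W`; `(W.ι)_w^*` is an isomorphism). [folklore] -/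
theorem stalkIdeal_map_ι_of_mem [QuasiSeparatedSpace Y] (W : Y.affineOpens) (I : Ideal Γ(Y, W)) (y : Y)
    (hy : y ∈ (W : Y.Opens)) :
    stalkIdeal ((Scheme.IdealSheafData.ofIdealTop (I.map (W : Y.Opens).topIso.inv.hom)).map (W : Y.Opens).ι) y =
      I.map (Y.presheaf.germ (W : Y.Opens) y hy).hom := by
  haveI : IsAffine ((W : Y.Opens) : Scheme.{u}) := W.2
  haveI : CompactSpace ((W : Y.Opens) : Scheme.{u}) := isCompact_iff_compactSpace.mp W.2.isCompact
  set j := (W : Y.Opens).ι with hj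
  set K := Scheme.IdealSheafData.ofIdealTop (I.map (W : Y.Opens).topIso.inv.hom) with hK
  have hbij : ∀ w : ((W : Y.Opens) : Scheme.{u}), Function.Bijective ((j.stalkMap w).hom) :=
    fun w => ConcreteCategory.bijective_of_isIso (j.stalkMap w)
  apply le_antisymm
  · -- `≤`: test a section over `W` at the point `⟨y, hy⟩` of `W`
    rw [stalkIdeal_eq_map_germ _ W hy, Ideal.map_le_iff_le_comap]
    intro t ht
    rw [Ideal.mem_comap]
    have h := (mem_map_ideal_iff j K W t).1 ht ⟨y, hy⟩ hy
    rw [← Scheme.Hom.germ_stalkMap_apply j (W : Y.Opens) ⟨y, hy⟩ hy, stalkIdeal_ofIdealTop_topIso] at h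
    have h2 : (Y.presheaf.germ (W : Y.Opens) (j.base ⟨y, hy⟩) hy).hom t ∈
        I.map (Y.presheaf.germ (W : Y.Opens) (j.base ⟨y, hy⟩) hy).hom := by
      rw [← Ideal.comap_map_of_bijective _ (hbij ⟨y, hy⟩) (I := I.map _), Ideal.mem_comap]
      exact h
    exact h2
  · -- `≥`: the sections of `I` lie in `K♯(W)`
    rw [stalkIdeal_eq_map_germ _ W hy]
    refine Ideal.map_mono fun s hs => ?_
    rw [mem_map_ideal_iff j K W s]
    intro w hw
    rw [← Scheme.Hom.germ_stalkMap_apply j (W : Y.Opens) w hw, stalkIdeal_ofIdealTop_topIso]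
    exact Ideal.mem_map_of_mem _ (Ideal.mem_map_of_mem _ hs)

/-- **THE EXTENSION IS `⊤` OFF THE CLOSURE OF `W ∩ V(I)`**: its support lies in `closure (W ∩ V(I))`
(`support_map` = closure of the image of the support; on `W` the support is read on the stalks). [folklore] -/
theorem support_map_ι_subset [QuasiSeparatedSpace Y] (W : Y.affineOpens) (I : Ideal Γ(Y, W)) :
    (((Scheme.IdealSheafData.ofIdealTop (I.map (W : Y.Opens).topIso.inv.hom)).map (W : Y.Opens).ι).support : Set Y) ⊆
      closure ((W : Set Y) ∩ Y.zeroLocus (U := (W : Y.Opens)) (I : Set Γ(Y, W))) := by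
  haveI : IsAffine ((W : Y.Opens) : Scheme.{u}) := W.2
  haveI : CompactSpace ((W : Y.Opens) : Scheme.{u}) := isCompact_iff_compactSpace.mp W.2.isCompact
  set j := (W : Y.Opens).ι with hj
  set K := Scheme.IdealSheafData.ofIdealTop (I.map (W : Y.Opens).topIso.inv.hom) with hK
  have hsupp : ((K.map j).support : Set Y) = closure (j.base '' (K.support : Set ((W : Y.Opens) : Scheme.{u}))) := by
    rw [Scheme.IdealSheafData.support_map]
    rfl
  rw [hsupp]
  refine closure_mono ?_
  rintro _ ⟨w, hw, rfl⟩
  have hwW : j.base w ∈ (W : Y.Opens) := w.2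
  refine ⟨hwW, ?_⟩
  -- `j w` lies in the support of `K♯`, read on the stalk at `j w ∈ W`
  have hmem : j.base w ∈ (K.map j).support := by
    have h1 : j.base w ∈ closure (j.base '' (K.support : Set ((W : Y.Opens) : Scheme.{u}))) :=
      subset_closure ⟨w, hw, rfl⟩
    rw [← hsupp] at h1
    exact h1
  rw [mem_support_iff_stalkIdeal_le, stalkIdeal_map_ι_of_mem W I (j.base w) hwW, Ideal.map_le_iff_le_comap] at hmem
  rw [Scheme.mem_zeroLocus_iff]
  intro f hf hfw
  have h2 := hmem hf
  rw [Ideal.mem_comap, IsLocalRing.mem_maximalIdeal, mem_nonunits_iff] at h2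
  exact h2 ((Y.mem_basicOpen f (j.base w) hwW).mp hfw)

/-- **EXTENSION OF A LOCAL MODEL** (`Y` quasi-separated; `W` affine, `I ⊆ Γ(Y, W)`): there is an ideal sheaf `K` on `Y` with
(i) stalks `I · 𝒪_{Y,y}` at every `y ∈ W`; (ii) support inside `closure (W ∩ V(I))` (so `K_y = ⊤` off it); (iii) `K(W) = I`;
(iv) MAXIMALITY: every ideal sheaf `J` with `J(W) ≤ I` satisfies `J ≤ K`. [folklore] -/
theorem exists_idealSheafData_of_ideal [QuasiSeparatedSpace Y] (W : Y.affineOpens) (I : Ideal Γ(Y, W)) :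
    ∃ K : Y.IdealSheafData,
      (∀ (y : Y) (hy : y ∈ (W : Y.Opens)), stalkIdeal K y = I.map (Y.presheaf.germ (W : Y.Opens) y hy).hom) ∧
      ((K.support : Set Y) ⊆ closure ((W : Set Y) ∩ Y.zeroLocus (U := (W : Y.Opens)) (I : Set Γ(Y, W)))) ∧
      K.ideal W = I ∧
      ∀ J : Y.IdealSheafData, J.ideal W ≤ I → J ≤ K := by
  haveI : IsAffine ((W : Y.Opens) : Scheme.{u}) := W.2
  haveI : CompactSpace ((W : Y.Opens) : Scheme.{u}) := isCompact_iff_compactSpace.mp W.2.isCompact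
  set j := (W : Y.Opens).ι with hj
  set K := Scheme.IdealSheafData.ofIdealTop (I.map (W : Y.Opens).topIso.inv.hom) with hK
  have hst := stalkIdeal_map_ι_of_mem W I
  refine ⟨K.map j, hst, support_map_ι_subset W I, ?_, fun J hJ => ?_⟩
  · -- (iii) sections over `W`, from the stalks
    apply le_antisymm
    · intro t ht
      have h := (mem_ideal_iff_forall_germ_mem_stalkIdeal (K.map j) W t).1 ht
      have key : Ideal.span {t} ≤ I := by
        rw [W.2.ideal_le_iff]
        intro y hy
        rw [Ideal.map_span, Set.image_singleton, Ideal.span_le, Set.singleton_subset_iff, SetLike.mem_coe, ← hst y hy]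
        exact h y hy
      exact key (Ideal.subset_span rfl)
    · intro t ht
      rw [mem_ideal_iff_forall_germ_mem_stalkIdeal]
      intro y hy
      rw [hst y hy]
      exact Ideal.mem_map_of_mem _ ht
  · -- (iv) maximality: `J ≤ K♯ ↔ J|_W ≤ K`, checked on the stalks of `W`
    rw [Scheme.IdealSheafData.le_map_iff_comap_le]
    refine le_of_forall_stalkIdeal_le fun w => ?_
    rw [stalkIdeal_comap_eq_map, stalkIdeal_ofIdealTop_topIso,
      stalkIdeal_eq_map_germ J W (show j.base w ∈ (W : Y.Opens) from w.2), Ideal.map_map, Ideal.map_map]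
    exact Ideal.map_mono hJ

/-! ## Gluing finitely many local models that agree stalkwise on the overlaps -/

/-- **CROSS-CHART SECTIONS**: if the models `(W, I)` and `(W', I')` agree stalkwise on `W ∩ W'`, then the sections of `I` over
`W` lie in the extension of `(W', I')` — `I ≤ K'♯(W)` (tested by `mem_map_ideal_iff` at the points of `W ∩ W'` only; the
boundary of `W'` inside `W` imposes nothing). [folklore] -/
theorem le_ideal_map_ι_of_agree [QuasiSeparatedSpace Y] (W W' : Y.affineOpens) (I : Ideal Γ(Y, W)) (I' : Ideal Γ(Y, W'))
    (hagree : ∀ (y : Y) (h : y ∈ (W : Y.Opens)) (h' : y ∈ (W' : Y.Opens)),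
      I.map (Y.presheaf.germ (W : Y.Opens) y h).hom = I'.map (Y.presheaf.germ (W' : Y.Opens) y h').hom) :
    I ≤ ((Scheme.IdealSheafData.ofIdealTop (I'.map (W' : Y.Opens).topIso.inv.hom)).map (W' : Y.Opens).ι).ideal W := by
  haveI : IsAffine ((W' : Y.Opens) : Scheme.{u}) := W'.2
  haveI : CompactSpace ((W' : Y.Opens) : Scheme.{u}) := isCompact_iff_compactSpace.mp W'.2.isCompact
  intro s hs
  rw [mem_map_ideal_iff]
  intro w hw
  have hw' : (W' : Y.Opens).ι.base w ∈ (W' : Y.Opens) := w.2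
  rw [← Scheme.Hom.germ_stalkMap_apply (W' : Y.Opens).ι (W : Y.Opens) w hw, stalkIdeal_ofIdealTop_topIso,
    ← hagree ((W' : Y.Opens).ι.base w) hw hw']
  exact Ideal.mem_map_of_mem _ (Ideal.mem_map_of_mem _ hs)

/-- **GLUING OF AFFINE LOCAL MODELS.**  On a quasi-separated scheme `Y` let `(W_ℓ, I_ℓ)_{ℓ ∈ L}` (`L` finite) be local models
that AGREE STALKWISE on the overlaps: `I_ℓ · 𝒪_{Y,y} = I_ℓ' · 𝒪_{Y,y}` for `y ∈ W_ℓ ∩ W_ℓ'`.  Then there is an ideal sheaf `R` on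
`Y` (namely `⨅_ℓ K_ℓ♯`) with: (i) stalks `I_ℓ · 𝒪_{Y,y}` at every `y ∈ W_ℓ`; (ii) `R_y = ⊤` at every `y` outside
`⋃_ℓ closure (W_ℓ ∩ V(I_ℓ))`; (iii) sections `R(W_ℓ) = I_ℓ`; (iv) MAXIMALITY: every ideal sheaf `J` with `J(W_ℓ) ≤ I_ℓ` for
all `ℓ` satisfies `J ≤ R`. [folklore] -/
theorem exists_idealSheafData_glue [QuasiSeparatedSpace Y] {L : Type} [Fintype L] (W : L → Y.affineOpens)
    (I : ∀ ℓ, Ideal Γ(Y, W ℓ))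
    (hagree : ∀ (ℓ ℓ' : L) (y : Y) (h : y ∈ (W ℓ : Y.Opens)) (h' : y ∈ (W ℓ' : Y.Opens)),
      (I ℓ).map (Y.presheaf.germ (W ℓ : Y.Opens) y h).hom = (I ℓ').map (Y.presheaf.germ (W ℓ' : Y.Opens) y h').hom) :
    ∃ R : Y.IdealSheafData,
      (∀ (ℓ : L) (y : Y) (hy : y ∈ (W ℓ : Y.Opens)), stalkIdeal R y = (I ℓ).map (Y.presheaf.germ (W ℓ : Y.Opens) y hy).hom) ∧
      (∀ y : Y, (∀ ℓ, y ∉ closure ((W ℓ : Set Y) ∩ Y.zeroLocus (U := (W ℓ : Y.Opens)) (I ℓ : Set Γ(Y, W ℓ)))) →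
        stalkIdeal R y = ⊤) ∧
      (∀ ℓ, R.ideal (W ℓ) = I ℓ) ∧
      ∀ J : Y.IdealSheafData, (∀ ℓ, J.ideal (W ℓ) ≤ I ℓ) → J ≤ R := by
  classical
  -- the extensions `K ℓ` of the local models
  set K : L → Y.IdealSheafData := fun ℓ =>
    (Scheme.IdealSheafData.ofIdealTop ((I ℓ).map (W ℓ : Y.Opens).topIso.inv.hom)).map (W ℓ : Y.Opens).ι with hK
  have hKst : ∀ (ℓ : L) (y : Y) (hy : y ∈ (W ℓ : Y.Opens)),
      stalkIdeal (K ℓ) y = (I ℓ).map (Y.presheaf.germ (W ℓ : Y.Opens) y hy).hom :=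
    fun ℓ y hy => stalkIdeal_map_ι_of_mem (W ℓ) (I ℓ) y hy
  have hKsupp : ∀ ℓ, ((K ℓ).support : Set Y) ⊆
      closure ((W ℓ : Set Y) ∩ Y.zeroLocus (U := (W ℓ : Y.Opens)) (I ℓ : Set Γ(Y, W ℓ))) :=
    fun ℓ => support_map_ι_subset (W ℓ) (I ℓ)
  have hcross : ∀ ℓ ℓ', I ℓ ≤ (K ℓ').ideal (W ℓ) :=
    fun ℓ ℓ' => le_ideal_map_ι_of_agree (W ℓ) (W ℓ') (I ℓ) (I ℓ') (hagree ℓ ℓ')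
  -- sections of the glued sheaf over the charts
  have hsec : ∀ ℓ, (⨅ ℓ', K ℓ').ideal (W ℓ) = I ℓ := by
    intro ℓ
    rw [Scheme.IdealSheafData.ideal_iInf, iInf_apply]
    apply le_antisymm
    · refine (iInf_le (fun ℓ' => (K ℓ').ideal (W ℓ)) ℓ).trans ?_
      intro t ht
      have h := (mem_ideal_iff_forall_germ_mem_stalkIdeal (K ℓ) (W ℓ) t).1 ht
      have key : Ideal.span {t} ≤ I ℓ := by
        rw [(W ℓ).2.ideal_le_iff]
        intro y hy
        rw [Ideal.map_span, Set.image_singleton, Ideal.span_le, Set.singleton_subset_iff, SetLike.mem_coe,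
          ← hKst ℓ y hy]
        exact h y hy
      exact key (Ideal.subset_span rfl)
    · exact le_iInf fun ℓ' => hcross ℓ ℓ'
  refine ⟨⨅ ℓ, K ℓ, fun ℓ y hy => ?_, fun y hy => ?_, hsec, fun J hJ => ?_⟩
  · -- (i) stalks on the charts, read off the sections over `W ℓ`
    rw [stalkIdeal_eq_map_germ _ (W ℓ) hy, hsec ℓ]
  · -- (ii) off all the closures every `K ℓ` has the unit stalk
    rw [← Finset.inf_univ_eq_iInf, stalkIdeal_finset_inf, Finset.inf_eq_top_iff]
    intro ℓ _
    exact stalkIdeal_eq_top_of_not_mem_support fun h => hy ℓ (hKsupp ℓ h)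
  · -- (iv) maximality, chart by chart (`J ≤ K♯ ↔ J|_W ≤ K`, on the stalks of `W`)
    refine le_iInf fun ℓ => ?_
    haveI : IsAffine ((W ℓ : Y.Opens) : Scheme.{u}) := (W ℓ).2
    change J ≤ (Scheme.IdealSheafData.ofIdealTop ((I ℓ).map (W ℓ : Y.Opens).topIso.inv.hom)).map (W ℓ : Y.Opens).ι
    rw [Scheme.IdealSheafData.le_map_iff_comap_le]
    refine le_of_forall_stalkIdeal_le fun w => ?_
    rw [stalkIdeal_comap_eq_map, stalkIdeal_ofIdealTop_topIso,
      stalkIdeal_eq_map_germ J (W ℓ) (show (W ℓ : Y.Opens).ι.base w ∈ (W ℓ : Y.Opens) from w.2), Ideal.map_map,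
      Ideal.map_map]
    exact Ideal.map_mono (hJ ℓ)

end Summit.ResolutionOfSingularities.ResolutionOfSingularities.Theorems.LocalModelSheaf

end
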